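import Summits.CriticalPhenomena.CardyFormulaZ2.Theorems.CardySusyWardParafermionFamiliesToSLESixAnchoredWallFluxToggle

/-!
# The strip anchor (stub S5 of line `strip-anchored-vertex-normalisation`, crux stmt-CriticalPhenomena-10814), IV:
# TouchPhase — the winding of the exploration at a free-wall touch does not depend on the configuration

Helper file for `stub_anchoredWallFlux`, closing the TouchPhase argument of parts II (`…AnchoredWallFluxTouch.lean`)
and III (`…AnchoredWallFluxToggle.lean`). Admissible data `E` with hole-free inner faces, completed configurations
`β = E.bcBondConfig ω`, cut orbits `orb` of the start corner, exit times `T = exitTime hE ω`.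

* `turnCount_toggle` — the dispatcher over the three landed toggle cases: if `β, β'` differ at exactly one edge
  `e`, every common dart `c = orb i = orb' i'` (`i < T`, `i' < T'`) has the same turn count in both. The edge is
  open in one of the two, hence a lattice edge, hence `e = cTgt p` for a corner `p` (`exists_cTgt_eq`); of the two
  corners `p`, `cornerPartner p` arriving at `e`, none / only `p` / both with `p` first being darts of the `ω`-path
  are the landed cases `turnCount_toggle_zero/one/two`, and the two remaining cases (only the partner; both, the
  partner first) are the same after exchanging `p` with its partner (`cTgt_partner`, `partner_partner`). The side
  condition of the one-dart case — no endpoint of `e` on the arc `B` — is forced by `hdiff`: the status of an edge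
  at a `B`-site does not depend on `ω` (`mem_bc_iff_of_mem_zdArcB`).
* `turnCount_eq_of_agree_off` — the same conclusion when `β, β'` merely agree off `e` (then they are equal, and
  orbits, exit times and dart indices coincide, or they differ exactly at `e`).
* `touch_mono` — a free-wall touch persists when edges of `ω` are opened: touched ⇔ joined to the arc `A`
  (part II, `reachable_start_of_orbit` / `touch_of_reachable`) and `bcBondConfig` is monotone.
* `touch_chain` — opening finitely many edges one at a time keeps the touch and its turn count
  (`Set.Finite.induction_on`; consecutive completed configurations agree off the opened edge).
* `turnCount_touch`, registered form `stub_anchor_phase` — **TouchPhase**: two arbitrary configurations touching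
  the free-wall site `w` at darts `orb n = (w, 0) = orb' n'` have equal turn counts there. Only the finite edge
  set `S` of `Ω_δ` matters, so the chains from `ω` up to `ω ∪ (ω' ∩ S)` and from `ω'` up to `ω' ∪ (ω ∩ S)` are
  finite and end at two configurations with the same completed configuration.
-/

noncomputable section

namespace Summit.CriticalPhenomena.CardyFormulaZ2.Theorems.ParafermionFamiliesToSLESix.StripAnchored

open Function
open Literature.Probability.Percolation (BondConfig)
open Literature.Probability.LatticeModels
open Literature.Probability.LatticeModels.DiscreteDobrushin (startCorner exitTime isStartCorner_startCorner
  isInnerFace_of_lt_exitTime not_isInnerFace_exitTime)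

namespace S5

variable {E : DiscreteDobrushin} {ω ω' : BondConfig (Site 2)}

/-! ## Edges: corners arriving at them, and the frozen ones -/

/-- Every lattice edge `s(x, x + u_k)` is the target edge of a corner, namely `(x, k + 3)`. [folklore] -/
theorem exists_cTgt_eq {e : Sym2 (Site 2)} (he : e ∈ (zdGraph 2).edgeSet) : ∃ p : Site 2 × Fin 4, cTgt p = e := by
  induction e using Sym2.ind with
  | _ x y =>
    obtain ⟨k, rfl⟩ := exists_eq_add_cornerUnit ((SimpleGraph.mem_edgeSet _).1 he)
    exact ⟨(x, k + 3), show s(x, x + cornerUnit (k + 3 + 1)) = _ by rw [fin4_add_three_add_one]⟩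

/-- Open edges of a completed configuration are lattice edges. [cite: Smirnov2001, §2] -/
theorem mem_edgeSet_of_mem_bc {e : Sym2 (Site 2)} (he : e ∈ E.bcBondConfig ω) : e ∈ (zdGraph 2).edgeSet :=
  SimpleGraph.edgeSet_subset_edgeSet.2 (meshGraph_le_zdGraph _ _)
    (SimpleGraph.edgeSet_subset_edgeSet.2 (discreteDomainGraph_le_meshGraph _ _) (E.bcBondConfig_subset ω he))

/-- **The status of an edge at a site of the arc `B` does not depend on the configuration**: it is open in the
completed configuration iff it is an edge of `Ω_δ` with all endpoints on the arc `A`. [cite: Smirnov2001, §2] -/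
theorem mem_bc_iff_of_mem_zdArcB {e : Sym2 (Site 2)} {x : Site 2} (hx : x ∈ e) (hxB : x ∈ E.zdArcB) :
    e ∈ E.bcBondConfig ω ↔ e ∈ (discreteDomainGraph E.Ω E.δ).edgeSet ∧ ∀ y ∈ e, y ∈ E.zdArcA := by
  rw [DiscreteDobrushin.mem_bcBondConfig_iff]
  constructor
  · rintro ⟨he, h | ⟨-, h⟩⟩
    · exact ⟨he, h⟩
    · exact absurd hxB (h x hx)
  · rintro ⟨he, h⟩
    exact ⟨he, Or.inl h⟩

/-! ## The dispatcher: toggle invariance of turn counts, all cases -/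

section Toggle

variable (hE : E.IsZdAdmissible)

/-- **Toggle invariance of turn counts.** If the completed configurations of `ω, ω'` differ at exactly one
edge `e`, every common dart `c = orb i = orb' i'` of the two exploration paths has the same turn count (winding
in quarter turns) in both. [cite: Smirnov2010, proof of Lemma 4.5] -/
theorem turnCount_toggle (hH : HoleFree {f : Site 2 | E.IsInnerFace f}) {e : Sym2 (Site 2)}
    (hagree : ∀ e', e' ≠ e → (e' ∈ E.bcBondConfig ω' ↔ e' ∈ E.bcBondConfig ω))
    (hdiff : ¬ (e ∈ E.bcBondConfig ω' ↔ e ∈ E.bcBondConfig ω))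
    {c : Site 2 × Fin 4} {i i' : ℕ} (hi : i < exitTime hE ω) (hi' : i' < exitTime hE ω')
    (hci : cornerOrbit (E.bcBondConfig ω) (startCorner hE) i = c)
    (hci' : cornerOrbit (E.bcBondConfig ω') (startCorner hE) i' = c) :
    turnCount (E.bcBondConfig ω) (startCorner hE) i = turnCount (E.bcBondConfig ω') (startCorner hE) i' := by
  -- `e` is open in one of the two, hence a lattice edge: the target edge of a corner `p`
  have he : e ∈ (zdGraph 2).edgeSet := by
    by_cases h : e ∈ E.bcBondConfig ω
    · exact mem_edgeSet_of_mem_bc h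
    · refine mem_edgeSet_of_mem_bc (E := E) (ω := ω') ?_
      by_contra h'
      exact hdiff ⟨fun h'' => absurd h'' h', fun h'' => absurd h'' h⟩
  obtain ⟨p, rfl⟩ := exists_cTgt_eq he
  -- no endpoint of `e` lies on the arc `B`, else the status of `e` would not depend on the configuration
  have hB : ∀ x ∈ cTgt p, x ∉ E.zdArcB := fun x hx hxB =>
    hdiff (by rw [mem_bc_iff_of_mem_zdArcB hx hxB, mem_bc_iff_of_mem_zdArcB hx hxB])
  by_cases h₁ : ∃ i₁ < exitTime hE ω, cornerOrbit (E.bcBondConfig ω) (startCorner hE) i₁ = p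
  · obtain ⟨i₁, hi₁N, hi₁⟩ := h₁
    by_cases h₂ : ∃ i₂ < exitTime hE ω, cornerOrbit (E.bcBondConfig ω) (startCorner hE) i₂ = cornerPartner p
    · obtain ⟨i₂, hi₂N, hi₂⟩ := h₂
      rcases lt_trichotomy i₁ i₂ with h12 | rfl | h21
      · exact turnCount_toggle_two hE hH hagree hdiff hi₁ hi₂ h12 hi₂N hi hi' hci hci'
      · exact absurd (hi₂.symm.trans hi₁) (partner_ne p)
      · -- both corners of `e` are darts, the partner first: exchange the two corners of `e`
        rw [← cTgt_partner p] at hagree hdiff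
        exact turnCount_toggle_two hE hH hagree hdiff hi₂ (by rw [partner_partner]; exact hi₁) h21 hi₁N hi hi'
          hci hci'
    · push Not at h₂
      exact turnCount_toggle_one hE hH hagree hdiff hB hi₁ hi₁N h₂ hi hi' hci hci'
  · push Not at h₁
    by_cases h₂ : ∃ i₂ < exitTime hE ω, cornerOrbit (E.bcBondConfig ω) (startCorner hE) i₂ = cornerPartner p
    · obtain ⟨i₂, hi₂N, hi₂⟩ := h₂
      -- only the partner is a dart: exchange the two corners of `e`
      rw [← cTgt_partner p] at hagree hdiff hB
      exact turnCount_toggle_one hE hH hagree hdiff hB hi₂ hi₂N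
        (fun j hj => by rw [partner_partner]; exact h₁ j hj) hi hi' hci hci'
    · push Not at h₂
      exact turnCount_toggle_zero hE hagree hdiff h₁ h₂ hi hi' hci hci'

/-- **Turn counts of common darts agree when the completed configurations agree off one edge** (they are then
equal — same orbit, exit time and dart index — or differ exactly at that edge).
[cite: Smirnov2010, proof of Lemma 4.5] -/
theorem turnCount_eq_of_agree_off (hH : HoleFree {f : Site 2 | E.IsInnerFace f}) {e : Sym2 (Site 2)}
    (hagree : ∀ e', e' ≠ e → (e' ∈ E.bcBondConfig ω' ↔ e' ∈ E.bcBondConfig ω))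
    {c : Site 2 × Fin 4} {i i' : ℕ} (hi : i < exitTime hE ω) (hi' : i' < exitTime hE ω')
    (hci : cornerOrbit (E.bcBondConfig ω) (startCorner hE) i = c)
    (hci' : cornerOrbit (E.bcBondConfig ω') (startCorner hE) i' = c) :
    turnCount (E.bcBondConfig ω) (startCorner hE) i = turnCount (E.bcBondConfig ω') (startCorner hE) i' := by
  by_cases hd : (e ∈ E.bcBondConfig ω' ↔ e ∈ E.bcBondConfig ω)
  · have hbc : E.bcBondConfig ω' = E.bcBondConfig ω := Set.ext fun e' => by
      by_cases h : e' = e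
      · rw [h]; exact hd
      · exact hagree e' h
    have hlt' : ∀ k < exitTime hE ω, E.IsInnerFace (cFace (cornerOrbit (E.bcBondConfig ω') (startCorner hE) k)) :=
      fun k hk => by rw [hbc]; exact isInnerFace_of_lt_exitTime hE ω hk
    rw [exitTime_eq_of hE ω' (by rw [hbc]; exact not_isInnerFace_exitTime hE ω) hlt'] at hi'
    obtain rfl : i' = i := orbit_inj hE hlt' hi' hi (by rw [hci', hbc, hci])
    rw [hbc]
  · exact turnCount_toggle hE hH hagree hd hi hi' hci hci'

/-! ## The monotone chain -/

/-- **A free-wall touch persists when edges are opened**: if the `ω`-exploration passes the corner `(w, 0)` of a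
free-wall site `w` and `ω ⊆ ω'`, so does the `ω'`-exploration, before its exit time.
[cite: DuminilCopin2012Parafermion, Proposition 5] -/
theorem touch_mono (hH : HoleFree {f : Site 2 | E.IsInnerFace f}) {w : Site 2} (hw : E.IsInnerFace w)
    (hw' : ¬ E.IsInnerFace (w + cornerUnit 0)) (hu : w + cornerUnit 0 + cornerUnit 1 ∈ E.zdArcB) (hle : ω ⊆ ω')
    {n : ℕ} (hwn : cornerOrbit (E.bcBondConfig ω) (startCorner hE) n = (w, 0)) :
    ∃ m < exitTime hE ω', cornerOrbit (E.bcBondConfig ω') (startCorner hE) m = (w, 0) := by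
  have hreach := reachable_start_of_orbit (E := E) (ω := ω) (startCorner hE) n
  rw [hwn] at hreach
  exact touch_of_reachable hE hH hw hw' hu (isStartCorner_startCorner hE).mem_zdArcA
    (hreach.mono (SimpleGraph.fromEdgeSet_mono (E.bcBondConfig_mono hle)))

/-- **Opening finitely many edges keeps the touch and its turn count**: for a finite set `s` of edges, the
`(ω ∪ s)`-exploration passes `(w, 0)` at some dart with the same turn count as the `ω`-exploration at its dart
`orb n = (w, 0)`. [cite: Smirnov2010, proof of Lemma 4.5] -/
theorem touch_chain (hH : HoleFree {f : Site 2 | E.IsInnerFace f}) {w : Site 2} (hw : E.IsInnerFace w)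
    (hw' : ¬ E.IsInnerFace (w + cornerUnit 0)) (hu : w + cornerUnit 0 + cornerUnit 1 ∈ E.zdArcB)
    {n : ℕ} (hn : n < exitTime hE ω) (hwn : cornerOrbit (E.bcBondConfig ω) (startCorner hE) n = (w, 0))
    {s : Set (Sym2 (Site 2))} (hs : s.Finite) :
    ∃ m < exitTime hE (ω ∪ s), cornerOrbit (E.bcBondConfig (ω ∪ s)) (startCorner hE) m = (w, 0) ∧
      turnCount (E.bcBondConfig (ω ∪ s)) (startCorner hE) m = turnCount (E.bcBondConfig ω) (startCorner hE) n := by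
  induction s, hs using Set.Finite.induction_on with
  | empty => rw [Set.union_empty]; exact ⟨n, hn, hwn, rfl⟩
  | @insert a s _ _ ih =>
    obtain ⟨m, hm, hwm, htc⟩ := ih
    rw [Set.union_insert]
    obtain ⟨m', hm', hwm'⟩ := touch_mono hE hH hw hw' hu (Set.subset_insert a (ω ∪ s)) hwm
    refine ⟨m', hm', hwm', ?_⟩
    rw [← htc]
    refine (turnCount_eq_of_agree_off hE hH (e := a) (fun e' he' => ?_) hm hm' hwm hwm').symm
    rw [DiscreteDobrushin.mem_bcBondConfig_iff, DiscreteDobrushin.mem_bcBondConfig_iff, Set.mem_insert_iff,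
      or_iff_right he']

/-- **TouchPhase.** For two configurations whose explorations pass the corner `(w, 0)` of a free-wall site `w`
(face `w` inner, face `w + e₀` not inner, `w + e₀ + e₁` on the arc `B`) at darts `orb n = (w, 0) = orb' n'`, the
turn counts (windings in quarter turns) there agree. [cite: Smirnov2010, proof of Lemma 4.5] -/
theorem turnCount_touch (hH : HoleFree {f : Site 2 | E.IsInnerFace f}) {w : Site 2} (hw : E.IsInnerFace w)
    (hw' : ¬ E.IsInnerFace (w + cornerUnit 0)) (hu : w + cornerUnit 0 + cornerUnit 1 ∈ E.zdArcB)
    {n n' : ℕ} (hn : n < exitTime hE ω) (hn' : n' < exitTime hE ω')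
    (hwn : cornerOrbit (E.bcBondConfig ω) (startCorner hE) n = (w, 0))
    (hwn' : cornerOrbit (E.bcBondConfig ω') (startCorner hE) n' = (w, 0)) :
    turnCount (E.bcBondConfig ω) (startCorner hE) n = turnCount (E.bcBondConfig ω') (startCorner hE) n' := by
  -- the edge set of `Ω_δ` is finite (inlined, as in the proof of `S1.integrable_comp_medialExploration'`; the
  -- named form `…EdgeCoherence.FixedRadiusCut.edgeSet_finite` lives in another crux's cone and is not imported)
  have hfin : (discreteDomainGraph E.Ω E.δ).edgeSet.Finite := by
    have hV : (meshDomain E.Ω E.δ).Finite := meshDomain_finite hE.isBounded hE.delta_pos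
    refine ((hV.prod hV).image (fun q : Site 2 × Site 2 => s(q.1, q.2))).subset fun e he => ?_
    induction e using Sym2.ind with
    | _ a b =>
      have hab := discreteDomainGraph_adj_iff.1 ((SimpleGraph.mem_edgeSet _).1 he)
      exact ⟨(a, b), ⟨hab.2.1, hab.2.2⟩, rfl⟩
  -- the two finite chains, from `ω` up to `ω ∪ (ω' ∩ S)` and from `ω'` up to `ω' ∪ (ω ∩ S)`
  obtain ⟨m, hm, hwm, htc⟩ := touch_chain hE hH hw hw' hu hn hwn (hfin.inter_of_right ω')
  obtain ⟨m', hm', hwm', htc'⟩ := touch_chain hE hH hw hw' hu hn' hwn' (hfin.inter_of_right ω)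
  rw [← htc, ← htc']
  -- their ends have the same completed configuration
  refine turnCount_eq_of_agree_off hE hH (e := cTgt (w, 0)) (fun e' _ => ?_) hm hm' hwm hwm'
  simp only [DiscreteDobrushin.mem_bcBondConfig_iff, Set.mem_union, Set.mem_inter_iff]
  tauto

end Toggle

end S5

/-- **Registered one-line form `stub_anchor_phase`** of `S5.turnCount_touch` (TouchPhase; helper of stub S5
`stub_anchoredWallFlux`): the winding of the exploration at a free-wall touch is configuration-independent.
[cite: Smirnov2010, proof of Lemma 4.5] -/
theorem stub_anchor_phase : ∀ (E : DiscreteDobrushin) (hE : E.IsZdAdmissible) (ω ω' : BondConfig (Site 2)) (w : Site 2) (n n' : ℕ), HoleFree {f : Site 2 | E.IsInnerFace f} → E.IsInnerFace w → ¬ E.IsInnerFace (w + cornerUnit 0) → w + cornerUnit 0 + cornerUnit 1 ∈ E.zdArcB → n < exitTime hE ω → n' < exitTime hE ω' → cornerOrbit (E.bcBondConfig ω) (startCorner hE) n = (w, 0) → cornerOrbit (E.bcBondConfig ω') (startCorner hE) n' = (w, 0) → turnCount (E.bcBondConfig ω) (startCorner hE) n = turnCount (E.bcBondConfig ω') (startCorner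 hE) n' :=
  fun _ hE _ _ _ _ _ hH hw hw' hu hn hn' hwn hwn' => S5.turnCount_touch hE hH hw hw' hu hn hn' hwn hwn'

end Summit.CriticalPhenomena.CardyFormulaZ2.Theorems.ParafermionFamiliesToSLESix.StripAnchored

end
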